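import Summits.Schanuel.Schanuel.Theses.DiophantineDichotomy
import Literature.NumberTheory.Transcendental.QuadraticRelationsLogarithmsSec3Thm31
import Literature.NumberTheory.Transcendental.PlaneCurveTranscendence
import Literature.NumberTheory.DiophantineApproximation.ApproximationByAlgebraicNumbersProofs

/-!
# Lifting algebraic approximations from one number to a point of a curve
# (helper for item `ApproximationPropertyDegOne`, stmt-Schanuel-11037)

Route `Schanuel/DiophantineDichotomy`, support item stmt-Schanuel-11037
(`Summit.Schanuel.Schanuel.Theses.DiophantineDichotomy.ApproximationPropertyDegOne`).  The item is the
case `t = 1` of Philippon's approximation property: a point `θ ∈ ℂ^ι` with `trdeg_ℚ ℚ(θ) ≤ 1` has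
algebraic approximations at all scales, certified in the naive `(d, log H)` currency (each coordinate
a root of a NON-ZERO INTEGER POLYNOMIAL of degree `≤ d` and naive height `≤ H`, joint degree
`[ℚ(γ):ℚ] ≤ d`).  For ONE number this is Diaz 1997 = Bugeaud 2004 Thm. 8.11 (in tree, discharged:
`Literature.NumberTheory.DiophantineApproximation.Bugeaud2004_thm_8_11_holds`).  This file is the
LIFTING from one number to all coordinates ("par des arguments standards", Laurent–Roy 1999 §§5–6;
Roy–Waldschmidt 1997, proof of Théorème 3.1 (i), pp. 764–765), in the naive currency.

* `exists_intPoly_of_logHeight₁_le` — dictionary Weil height → naive certificate: an element `x` of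
  a number field `F ⊂ ℂ` with `logHeight₁ x ≤ B` (Mathlib's `Height.logHeight₁`, relative to `F`) is
  a root of a non-zero `P ∈ ℤ[X]` with `deg P ≤ [F:ℚ]` and all `|coeff| ≤ 2^{[F:ℚ]} e^B` (its primitive
  irreducible polynomial: `log M(P) = deg P · h(x)` by the tree's `MahlerWeil.weilHeight₁_root_eq`,
  `deg P · h(x) ≤ logHeight₁ x`, and `|coeff_k| ≤ C(deg P, k) M(P)`);
  `finrank_adjoin_range_le_of_mem`, `natCeil_certificate` — joint degree inside `F`, rounding.
* `lift` — let `K ⊂ ℂ` be a function field of one variable over `ℚ` (finitely generated,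
  `trdeg 1`), `θ₀ ∈ K` transcendental and `a : ι → K`.  There are `ε₀ > 0`, `A ≥ 1` and `m ≥ 1`
  such that every algebraic `α` with irreducible polynomial `P ∈ ℤ[X]` and `|α − θ₀| ≤ ε₀` lifts to
  a point `γ ∈ ℂ^ι` and natural numbers `D, H` with `deg P ≤ D ≤ A·deg P`, `[ℚ(γ):ℚ] ≤ D`, every
  `γᵢ` a root of a non-zero integer polynomial of degree `≤ D` and naive height `≤ H`,
  `log H ≤ A (deg P + log M(P))` (Mahler measure), and `|γᵢ − aᵢ| ≤ A |α − θ₀|^{1/m}`.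
  The proof re-runs the tree's formalisation of Roy–Waldschmidt's reduction
  (`Literature/NumberTheory/Transcendental/QuadraticRelationsLogarithmsSec3Thm31.lean`): write
  `K = ℚ(θ₀)(β)` with `β` integral over `ℚ[θ₀]` (`exists_integral_generator`),
  `aᵢ = Gᵢ(θ₀,β)/Qᵢ(θ₀)` (`exists_fraction_repr`), take `γᵢ = Gᵢ(α, β̃)/Qᵢ(α)` for a root `β̃` of
  the specialised minimal polynomial of `β` (`approx_step`, crude root bound
  `|β̃ − β|^m ≤ |M_α(β)| ≪ |α − θ₀|`), work in the number field `K̃ ∋ α, β̃` of degree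
  `D ≤ [K:ℚ(θ₀)]·deg α` attached to the specialisation (`exists_place_of_specialization`), bound the
  Weil heights by `h(γ) ≤ [K̃:ℚ]C₂ + C₁ h(α)` (`height_step`) and `h(α) = log M(P)/deg P`
  (`MahlerWeil.weilHeight₁_root_le`), and convert to naive certificates.  Only the output currency
  differs from `RoyWaldschmidt1997.thm_3_1`.

No definitions, no named facts.
-/

set_option linter.dupNamespace false

noncomputable section

namespace Summit.Schanuel.Schanuel.Theorems.ApproximationPropertyDegOne

open Polynomial Finset IntermediateField
open Literature.NumberTheory.Transcendental (weilHeight₁ numberField_of_intermediateField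
  weilHeight₁_single_eq)
open Literature.NumberTheory.Transcendental.RoyWaldschmidt1997
open Literature.NumberTheory.DiophantineGeometry
open Literature.NumberTheory.DiophantineGeometry.AlgFunctionField

/-! ## Naive certificates from Weil heights -/

/-- **Naive certificate from a Weil height bound.**  If `x` lies in the number field `F ⊂ ℂ` and its
logarithmic height relative to `F` satisfies `logHeight₁ x ≤ B`, then `x` is a root of a non-zero
integer polynomial `P` with `deg P ≤ [F:ℚ]` and `|coeff_k P| ≤ 2^{[F:ℚ]} · e^B` for all `k` (namely its
primitive irreducible polynomial: `log M(P) = deg P · h(x) ≤ logHeight₁ x ≤ B` and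
`|coeff_k| ≤ C(deg P, k) · M(P) ≤ 2^{deg P} M(P)`). [folklore] -/
theorem exists_intPoly_of_logHeight₁_le (F : IntermediateField ℚ ℂ) [FiniteDimensional ℚ F]
    [NumberField F] (x : F) {B : ℝ} (hB : Height.logHeight₁ x ≤ B) :
    ∃ P : ℤ[X], P ≠ 0 ∧ P.natDegree ≤ Module.finrank ℚ F ∧
      (∀ k, (|P.coeff k| : ℝ) ≤ 2 ^ Module.finrank ℚ F * Real.exp B) ∧ aeval (x : ℂ) P = 0 := by
  have hxalg : IsAlgebraic ℚ (x : ℂ) :=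
    IntermediateField.isAlgebraic_iff.mp (Algebra.IsAlgebraic.isAlgebraic x)
  obtain ⟨P, hPirr, -, hPdeg, hPx⟩ :=
    Literature.NumberTheory.Transcendental.PlaneCurve.exists_irreducible_isPrimitive_aeval_eq_zero hxalg
  set D : ℕ := Module.finrank ℚ F with hD
  set M : ℝ := (P.map (Int.castRingHom ℂ)).mahlerMeasure with hM
  have hDpos : 0 < D := Module.finrank_pos
  have hDR : (0 : ℝ) < D := by exact_mod_cast hDpos
  have hdR : (0 : ℝ) < P.natDegree := by exact_mod_cast hPdeg
  -- `deg P = deg minpoly_ℚ x ≤ [F:ℚ]`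
  have hdegle : P.natDegree ≤ D := by
    -- Gauss: `minpoly_ℚ x = P / lead P`, so `deg P = deg minpoly_ℚ x ≤ [F:ℚ]`
    have hprim : P.IsPrimitive := hPirr.isPrimitive hPdeg.ne'
    have hirrQ : Irreducible (P.map (Int.castRingHom ℚ)) :=
      (IsPrimitive.Int.irreducible_iff_irreducible_map_cast hprim).1 hPirr
    have hzQ : aeval (x : ℂ) (P.map (Int.castRingHom ℚ)) = 0 := by
      rw [← algebraMap_int_eq, aeval_map_algebraMap]; exact hPx
    have key := minpoly.eq_of_irreducible hirrQ hzQ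
    have h1 : (minpoly ℚ (x : ℂ)).natDegree = P.natDegree := by
      rw [← key, natDegree_mul_C, natDegree_map_eq_of_injective (Int.castRingHom ℚ).injective_int]
      exact inv_ne_zero (leadingCoeff_ne_zero.2 hirrQ.ne_zero)
    have h2 : minpoly ℚ (x : ℂ) = minpoly ℚ x :=
      minpoly.algebraMap_eq (algebraMap F ℂ).injective x
    rw [← h1, h2]
    exact minpoly.natDegree_le x
  -- `log M = deg P · h(x) ≤ logHeight₁ x ≤ B`
  have hM1 : 1 ≤ M := Literature.NumberTheory.DiophantineApproximation.one_le_mahlerMeasure_map P hPirr.ne_zero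
  have hroot := MahlerWeil.weilHeight₁_root_eq P hPirr hPdeg hPx F x.2
  have hsingle := weilHeight₁_single_eq F x.2
  have hx0 : 0 ≤ Height.logHeight₁ x := Height.zero_le_logHeight₁ x
  have hlogM : Real.log M ≤ B := by
    have e : Real.log M / P.natDegree = Height.logHeight₁ x / D := by
      rw [hM, ← hroot, hsingle]
    rw [div_eq_div_iff hdR.ne' hDR.ne'] at e
    -- `log M · D = logHeight₁ x · deg P ≤ logHeight₁ x · D`
    have h1 : Height.logHeight₁ x * P.natDegree ≤ Height.logHeight₁ x * D :=
      mul_le_mul_of_nonneg_left (by exact_mod_cast hdegle) hx0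
    have h2 : Real.log M * D ≤ B * D := by
      rw [e]; exact h1.trans (mul_le_mul_of_nonneg_right hB hDR.le)
    exact le_of_mul_le_mul_right h2 hDR
  have hMB : M ≤ Real.exp B := by
    rw [← Real.exp_log (lt_of_lt_of_le one_pos hM1)]
    exact Real.exp_le_exp.mpr hlogM
  refine ⟨P, hPirr.ne_zero, hdegle, fun k => ?_, hPx⟩
  have h1 := norm_coeff_le_choose_mul_mahlerMeasure k (P.map (Int.castRingHom ℂ))
  rw [coeff_map, eq_intCast, Complex.norm_intCast,
    natDegree_map_eq_of_injective (Int.castRingHom ℂ).injective_int] at h1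
  have h2 : ((P.natDegree.choose k : ℕ) : ℝ) ≤ 2 ^ D := by
    have h3 : P.natDegree.choose k ≤ 2 ^ D :=
      (Nat.choose_le_two_pow _ _).trans (Nat.pow_le_pow_right two_pos hdegle)
    exact_mod_cast h3
  calc |(P.coeff k : ℝ)| ≤ (P.natDegree.choose k : ℝ) * M := h1
    _ ≤ 2 ^ D * Real.exp B := mul_le_mul h2 hMB (by linarith) (by positivity)

/-- The joint degree of a tuple of elements of a number field `F ⊂ ℂ` is at most `[F:ℚ]`:
`ℚ(γ) ⊆ F`. [folklore] -/
theorem finrank_adjoin_range_le_of_mem (F : IntermediateField ℚ ℂ) [FiniteDimensional ℚ F]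
    {ι : Type*} (γ : ι → ℂ) (h : ∀ i, γ i ∈ F) :
    Module.finrank ℚ ↥(IntermediateField.adjoin ℚ (Set.range γ)) ≤ Module.finrank ℚ F :=
  IntermediateField.finrank_le_of_le_right
    (IntermediateField.adjoin_le_iff.mpr (Set.range_subset_iff.mpr h))

/-- Rounding a real bound `T ≥ 1` up to `H = ⌈T⌉₊`: `T ≤ H`, `1 ≤ H` and `log H ≤ log T + 1`.
[folklore] -/
theorem natCeil_certificate {T : ℝ} (hT : 1 ≤ T) :
    T ≤ (⌈T⌉₊ : ℕ) ∧ 1 ≤ ⌈T⌉₊ ∧ Real.log (⌈T⌉₊ : ℕ) ≤ Real.log T + 1 := by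
  have h1 : T ≤ (⌈T⌉₊ : ℕ) := Nat.le_ceil T
  have h2 : 1 ≤ ⌈T⌉₊ := Nat.one_le_ceil_iff.mpr (lt_of_lt_of_le one_pos hT)
  refine ⟨h1, h2, ?_⟩
  have h3 : ((⌈T⌉₊ : ℕ) : ℝ) < T + 1 := Nat.ceil_lt_add_one (by linarith)
  have h4 : ((⌈T⌉₊ : ℕ) : ℝ) ≤ 2 * T := by linarith
  have hT0 : 0 < T := by linarith
  calc Real.log ((⌈T⌉₊ : ℕ) : ℝ) ≤ Real.log (2 * T) :=
        Real.log_le_log (by exact_mod_cast (lt_of_lt_of_le one_pos h2)) h4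
    _ = Real.log 2 + Real.log T := Real.log_mul (by norm_num) hT0.ne'
    _ ≤ Real.log T + 1 := by
        have : Real.log 2 ≤ 1 := by
          have := Real.log_two_lt_d9; norm_num at this; linarith
        linarith


/-! ## The lifting lemma -/

set_option maxHeartbeats 4000000 in
/-- **Lifting lemma (naive currency).**  Let `K ⊂ ℂ` be a function field of one variable over `ℚ`,
`θ₀ ∈ K` transcendental and `a : ι → K` finitely many elements.  There are constants `ε₀ > 0`,
`A ≥ 1`, `m ≥ 1` (depending only on `K, θ₀, a`) such that for every irreducible `P ∈ ℤ[X]` with a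
complex root `α` satisfying `|α − θ₀| ≤ ε₀` there exist `γ : ι → ℂ` and `D H : ℕ` with
`deg P ≤ D ≤ A · deg P`, `[ℚ(γ):ℚ] ≤ D`, each `γᵢ` a root of a non-zero `Qᵢ ∈ ℤ[X]` of degree `≤ D`
and coefficients `≤ H` in absolute value, `1 ≤ H`, `log H ≤ A (deg P + log M(P))`, and
`|γᵢ − aᵢ| ≤ A |α − θ₀|^{1/m}` for all `i`.
[cite: RoyWaldschmidt1997ENS, proof of Théorème 3.1 (i), pp. 764–765; LaurentRoy1999 §§5–6] -/
theorem lift {K : IntermediateField ℚ ℂ} [IsAlgFunctionField ℚ K] (θ₀ : K)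
    (hθ₀ : Transcendental ℚ θ₀) {ι : Type} [Fintype ι] (a : ι → K) :
    ∃ ε₀ : ℝ, 0 < ε₀ ∧ ∃ A : ℝ, 1 ≤ A ∧ ∃ m : ℕ, 0 < m ∧
      ∀ (P : ℤ[X]) (α : ℂ), Irreducible P → aeval α P = 0 → ‖α - θ₀‖ ≤ ε₀ →
        ∃ (γ : ι → ℂ) (D H : ℕ), P.natDegree ≤ D ∧ (D : ℝ) ≤ A * P.natDegree ∧
          Module.finrank ℚ ↥(IntermediateField.adjoin ℚ (Set.range γ)) ≤ D ∧
          (∀ i, ∃ Q : ℤ[X], Q ≠ 0 ∧ Q.natDegree ≤ D ∧ (∀ k, |Q.coeff k| ≤ (H : ℤ)) ∧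
            aeval (γ i) Q = 0) ∧
          1 ≤ H ∧
          Real.log H ≤ A * (P.natDegree + Real.log (P.map (Int.castRingHom ℂ)).mahlerMeasure) ∧
          ∀ i, ‖γ i - a i‖ ≤ A * ‖α - θ₀‖ ^ (1 / (m : ℝ)) := by
  classical
  /- ## the data: `β`, the coordinates of the `aᵢ`, the minimal polynomial of `β` -/
  obtain ⟨β, hβint, hβtop⟩ := exists_integral_generator θ₀ hθ₀
  have hrep := fun i => exists_fraction_repr θ₀ β hβint hβtop (a i)
  choose s c Q hQ0 hrepr using hrep
  obtain ⟨Mq, hMqdef⟩ : ∃ Mq : Polynomial ℚ[X], Mq = (minpoly (Algebra.adjoin ℚ {θ₀}) β).map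
      (Polynomial.algEquivOfTranscendental ℚ θ₀ hθ₀).symm.toAlgHom.toRingHom := ⟨_, rfl⟩
  obtain ⟨hMqmonic, hm, hMqθβ⟩ := minpoly_transport θ₀ hθ₀ β hβint Mq hMqdef
  set m : ℕ := Mq.natDegree with hmdef
  set DXM : ℕ := (range (m + 1)).sup fun k => (Mq.coeff k).natDegree with hDXM
  set cM : ℕ × ℕ → ℚ := fun pr => (Mq.coeff pr.2).coeff pr.1 with hcM
  have hMqX : ∀ k, (Mq.coeff k).natDegree ≤ DXM := by
    intro k
    by_cases hk : k ≤ m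
    · exact Finset.le_sup (f := fun k => (Mq.coeff k).natDegree) (mem_range.mpr (Nat.lt_succ_of_le hk))
    · rw [coeff_eq_zero_of_natDegree_lt (lt_of_not_ge hk), natDegree_zero]; exact Nat.zero_le _
  have hMqsum : ∀ (R : Type) [CommRing R] [Algebra ℚ R] (x y : R),
      Mq.eval₂ (Polynomial.aeval x : ℚ[X] →ₐ[ℚ] R).toRingHom y =
        ∑ pr ∈ range (DXM + 1) ×ˢ range (m + 1), algebraMap ℚ R (cM pr) * x ^ pr.1 * y ^ pr.2 :=
    fun R _ _ x y => eval₂_eq_doubleSum Mq hMqX le_rfl x y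
  have hc0 : cM (0, m) = 1 := by
    simp only [hcM, hmdef, hMqmonic.coeff_natDegree, coeff_one_zero]
  have hcpos : ∀ i, 0 < i → cM (i, m) = 0 := by
    intro i hi
    simp only [hcM, hmdef, hMqmonic.coeff_natDegree]
    rw [coeff_one]; simp [hi.ne']
  have hMqsumC : ∀ x y : ℂ, Mq.eval₂ (Polynomial.aeval x : ℚ[X] →ₐ[ℚ] ℂ).toRingHom y =
      ∑ pr ∈ range (DXM + 1) ×ˢ range (m + 1), ((cM pr : ℚ) : ℂ) * x ^ pr.1 * y ^ pr.2 := by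
    intro x y
    rw [hMqsum ℂ x y]
    simp only [eq_ratCast]
  have hMθβ' : ∑ pr ∈ range (DXM + 1) ×ˢ range (m + 1),
      ((cM pr : ℚ) : ℂ) * (θ₀ : ℂ) ^ pr.1 * (β : ℂ) ^ pr.2 = 0 := by
    rw [← hMqsumC (θ₀ : ℂ) (β : ℂ)]; exact hMqθβ
  /- ## the constants -/
  obtain ⟨ε₀, hε₀, E, hE0, happrox⟩ := approx_step (θ₀ : ℂ) (β : ℂ)
    (range (DXM + 1) ×ˢ range (m + 1)) cM Mq hMqmonic hm hMqsumC hMθβ' s c Q (fun i h0 => hQ0 i (by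
      rw [← coe_aeval] at h0
      exact_mod_cast h0))
  obtain ⟨C₁, C₂, hC₁, hC₂, hheight⟩ := height_step s c Q (DX := DXM) hm cM hc0 hcpos
  haveI : FiniteDimensional (IntermediateField.adjoin ℚ {θ₀}) K :=
    IsAlgFunctionField.finiteDimensional_adjoin_simple hθ₀
  set M₀ : ℕ := Module.finrank (IntermediateField.adjoin ℚ {θ₀}) K with hM₀
  have hM₀pos : 0 < M₀ := Module.finrank_pos
  have hM₀R : (1 : ℝ) ≤ M₀ := by exact_mod_cast hM₀pos
  -- the master constant
  set A : ℝ := (E + 1) + M₀ * (C₂ + 3) + C₁ * M₀ with hA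
  have hA1 : 1 ≤ A := by
    rw [hA]
    have : (0 : ℝ) ≤ M₀ * (C₂ + 3) := by positivity
    have : (0 : ℝ) ≤ C₁ * M₀ := by positivity
    linarith
  have hAE : E ≤ A := by
    rw [hA]
    have : (0 : ℝ) ≤ M₀ * (C₂ + 3) := by positivity
    have : (0 : ℝ) ≤ C₁ * M₀ := by positivity
    linarith
  have hAM₀ : (M₀ : ℝ) ≤ A := by
    rw [hA]
    have : (M₀ : ℝ) ≤ M₀ * (C₂ + 3) := le_mul_of_one_le_right (by positivity) (by linarith)
    have : (0 : ℝ) ≤ C₁ * M₀ := by positivity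
    linarith
  refine ⟨ε₀, hε₀, A, hA1, m, hm, fun P α hPirr hαP hαε => ?_⟩
  /- ## the algebraic approximation `α` -/
  have hP0 : P ≠ 0 := hPirr.ne_zero
  have hd : 0 < P.natDegree := by
    refine Nat.pos_of_ne_zero fun h0 => ?_
    have hc : P = C (P.coeff 0) := Polynomial.eq_C_of_natDegree_eq_zero h0
    have hc0 : P.coeff 0 = 0 := by
      rwa [hc, aeval_C, algebraMap_int_eq, eq_intCast, Int.cast_eq_zero] at hαP
    rw [hc0, C_0] at hc
    exact hP0 hc
  set d : ℕ := P.natDegree with hddef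
  have hdR : (1 : ℝ) ≤ d := by exact_mod_cast hd
  obtain ⟨hαint, hαdeg⟩ := natDegree_minpoly_of_irreducible P hPirr hd hαP
  set LMP : ℝ := Real.log (P.map (Int.castRingHom ℂ)).mahlerMeasure with hLMP
  have hLMP0 : 0 ≤ LMP :=
    Real.log_nonneg (Literature.NumberTheory.DiophantineApproximation.one_le_mahlerMeasure_map P hP0)
  /- ## the root `β̃` and the number field `K̃` -/
  obtain ⟨βt, hβteval, hβt1, hQα0, hdist⟩ := happrox α hαε
  -- `β̃` is integral over `ℚ`: a root of the monic `M_α ∈ ℚ(α)[Y]`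
  have hβtint : IsIntegral ℚ βt := by
    set F₁ : IntermediateField ℚ ℂ := IntermediateField.adjoin ℚ {α} with hF₁
    haveI : FiniteDimensional ℚ F₁ := IntermediateField.adjoin.finiteDimensional hαint
    have hαF₁ : α ∈ F₁ := IntermediateField.mem_adjoin_simple_self ℚ α
    set Pβ : F₁[X] := Mq.map (Polynomial.aeval (⟨α, hαF₁⟩ : F₁) : ℚ[X] →ₐ[ℚ] F₁).toRingHom with hPβ
    have hPβmonic : Pβ.Monic := hMqmonic.map _
    have hPβroot : aeval βt Pβ = 0 := by
      rw [hPβ, aeval_def, eval₂_map]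
      have hcomp : (algebraMap F₁ ℂ).comp
          (Polynomial.aeval (⟨α, hαF₁⟩ : F₁) : ℚ[X] →ₐ[ℚ] F₁).toRingHom =
          (Polynomial.aeval α : ℚ[X] →ₐ[ℚ] ℂ).toRingHom := by
        apply Polynomial.ringHom_ext
        · intro q; simp
        · simp only [RingHom.comp_apply, AlgHom.toRingHom_eq_coe, AlgHom.coe_toRingHom, aeval_X]; rfl
      rw [hcomp]
      exact hβteval
    have h1 : IsIntegral F₁ βt := ⟨Pβ, hPβmonic, by rwa [← aeval_def]⟩
    exact isIntegral_trans βt h1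
  obtain ⟨p, τ, Kt, -, hKt, hfd, hdegKt, ⟨hθr, hτθ⟩, ⟨hβr, hτβ⟩, hdD, hDd⟩ :=
    exists_place_of_specialization θ₀ hθ₀ β hβint hαint hβtint (by rw [← hMqdef]; exact hβteval)
  haveI := hfd
  haveI : NumberField Kt := numberField_of_intermediateField Kt
  rw [hαdeg] at hdD hDd
  set D : ℕ := p.deg with hDdef
  have hDpos : 0 < D := lt_of_lt_of_le hd hdD
  have hDR : (d : ℝ) ≤ D := by exact_mod_cast hdD
  have hDRpos : (0 : ℝ) < D := by exact_mod_cast hDpos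
  have hDM₀ : (D : ℝ) ≤ M₀ * d := by exact_mod_cast hDd
  have hαKt : α ∈ Kt := by have h := hKt ⟨θ₀, hθr⟩; rwa [hτθ] at h
  have hβKt : βt ∈ Kt := by have h := hKt ⟨β, hβr⟩; rwa [hτβ] at h
  set αK : Kt := ⟨α, hαKt⟩ with hαK
  set βK : Kt := ⟨βt, hβKt⟩ with hβK
  /- ## the lifted point `γ` -/
  set γ : ι → ℂ := fun i =>
    (∑ pr ∈ s i, ((c i pr : ℚ) : ℂ) * α ^ pr.1 * βt ^ pr.2) / aeval α (Q i) with hγ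
  set aK : ι → Kt := fun i =>
    (∑ pr ∈ s i, (c i pr : Kt) * αK ^ pr.1 * βK ^ pr.2) / aeval αK (Q i) with haK
  have haKcoe : ∀ i, ((aK i : Kt) : ℂ) = γ i := by
    intro i
    rw [hγ, haK]
    push_cast
    rw [coe_aeval]
  have hγKt : ∀ i, γ i ∈ Kt := fun i => by rw [← haKcoe i]; exact (aK i).2
  /- ## the heights -/
  have hrelKt : (∑ pr ∈ range (DXM + 1) ×ˢ range (m + 1),
      (cM pr : Kt) * αK ^ pr.1 * βK ^ pr.2) = 0 := by
    have h1 : ((∑ pr ∈ range (DXM + 1) ×ˢ range (m + 1),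
        (cM pr : Kt) * αK ^ pr.1 * βK ^ pr.2 : Kt) : ℂ) =
        ∑ pr ∈ range (DXM + 1) ×ˢ range (m + 1), ((cM pr : ℚ) : ℂ) * α ^ pr.1 * βt ^ pr.2 := by
      push_cast; rfl
    rw [← hMqsumC, hβteval] at h1
    exact_mod_cast h1
  have hh := hheight Kt αK βK hrelKt
  rw [hdegKt] at hh
  -- `logHeight₁ α ≤ D log M(P)/d ≤ M₀ log M(P)`
  have hαh : Height.logHeight₁ αK ≤ M₀ * LMP := by
    have h1 := MahlerWeil.weilHeight₁_root_le P hPirr hd hαP Kt hαKt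
    have h3 := weilHeight₁_single_eq Kt hαKt
    rw [hdegKt] at h3
    rw [h3, div_le_iff₀ hDRpos] at h1
    have hdpos : (0 : ℝ) < d := by linarith
    calc Height.logHeight₁ αK ≤ LMP / d * D := h1
      _ ≤ LMP / d * (M₀ * d) := mul_le_mul_of_nonneg_left hDM₀ (div_nonneg hLMP0 hdpos.le)
      _ = M₀ * LMP := by field_simp
  -- the height of each coordinate
  set B : ℝ := M₀ * d * C₂ + C₁ * (M₀ * LMP) with hB
  have hBi : ∀ i, Height.logHeight₁ (aK i) ≤ B := by
    intro i
    have h1 : Height.logHeight₁ (aK i) ≤ ∑ j, Height.logHeight₁ (aK j) :=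
      Finset.single_le_sum (f := fun j => Height.logHeight₁ (aK j))
        (fun j _ => Height.zero_le_logHeight₁ _) (mem_univ i)
    have h2 : ∑ j, Height.logHeight₁ (aK j) ≤ D * C₂ + C₁ * Height.logHeight₁ αK := hh
    have h3 : (D : ℝ) * C₂ ≤ M₀ * d * C₂ := mul_le_mul_of_nonneg_right hDM₀ hC₂
    have h4 : C₁ * Height.logHeight₁ αK ≤ C₁ * (M₀ * LMP) := mul_le_mul_of_nonneg_left hαh hC₁
    rw [hB]; linarith
  -- naive certificates
  have hcert := fun i => exists_intPoly_of_logHeight₁_le Kt (aK i) (hBi i)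
  choose R hR0 hRdeg hRcoeff hRroot using hcert
  set T : ℝ := 2 ^ D * Real.exp B with hT
  have hT1 : 1 ≤ T := by
    rw [hT]
    have h1 : (1 : ℝ) ≤ 2 ^ D := one_le_pow₀ (by norm_num)
    have h2 : 1 ≤ Real.exp B := by
      rw [← Real.exp_zero]; apply Real.exp_le_exp.mpr
      rw [hB]; positivity
    nlinarith
  obtain ⟨hTH, hH1, hlogH⟩ := natCeil_certificate hT1
  set H : ℕ := ⌈T⌉₊ with hHdef
  refine ⟨γ, D, H, hdD, hDM₀.trans (mul_le_mul_of_nonneg_right hAM₀ (by positivity)),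
    (finrank_adjoin_range_le_of_mem Kt γ hγKt).trans hdegKt.le, fun i => ⟨R i, hR0 i, (hRdeg i).trans hdegKt.le,
      fun k => ?_, ?_⟩, hH1, ?_, fun i => ?_⟩
  · -- `|coeff| ≤ H`
    have h1 : (|(R i).coeff k| : ℝ) ≤ T := by
      have h := hRcoeff i k; rw [hdegKt] at h; exact h
    exact_mod_cast h1.trans hTH
  · rw [← haKcoe i]; exact hRroot i
  · -- `log H ≤ log T + 1 = D log 2 + B + 1 ≤ A (d + log M(P))`
    have h1 : Real.log T = D * Real.log 2 + B := by
      rw [hT, Real.log_mul (by positivity) (Real.exp_pos _).ne', Real.log_pow, Real.log_exp]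
    have hlog2 : Real.log 2 ≤ 1 := by
      have := Real.log_two_lt_d9; norm_num at this; linarith
    have h2 : (D : ℝ) * Real.log 2 ≤ M₀ * d := by
      calc (D : ℝ) * Real.log 2 ≤ D * 1 := mul_le_mul_of_nonneg_left hlog2 hDRpos.le
        _ = D := mul_one _
        _ ≤ M₀ * d := hDM₀
    have h3 : (1 : ℝ) ≤ M₀ * d := by nlinarith
    -- `log H ≤ M₀ d + (M₀ d C₂ + C₁ M₀ LMP) + 1 ≤ M₀ (C₂ + 3) d + C₁ M₀ LMP ≤ A (d + LMP)`
    have h4 : Real.log H ≤ M₀ * (C₂ + 3) * d + C₁ * M₀ * LMP := by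
      have := hlogH; rw [h1, hB] at this; nlinarith
    have h5 : M₀ * (C₂ + 3) * (d : ℝ) ≤ A * d :=
      mul_le_mul_of_nonneg_right (by rw [hA]; nlinarith [hE0, hC₁, hM₀R]) (by positivity)
    have h6 : C₁ * M₀ * LMP ≤ A * LMP :=
      mul_le_mul_of_nonneg_right (by rw [hA]; nlinarith [hE0, hC₂, hM₀R]) hLMP0
    calc Real.log H ≤ M₀ * (C₂ + 3) * d + C₁ * M₀ * LMP := h4
      _ ≤ A * d + A * LMP := add_le_add h5 h6
      _ = A * (d + LMP) := by ring
  · -- the distance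
    have hacoe : (a i : ℂ) = (∑ pr ∈ s i, ((c i pr : ℚ) : ℂ) * (θ₀ : ℂ) ^ pr.1 * (β : ℂ) ^ pr.2) /
        aeval (θ₀ : ℂ) (Q i) := by
      rw [eq_div_iff (by rw [← coe_aeval]; exact_mod_cast hQ0 i), ← coe_aeval, ← coe_doubleSum]
      exact_mod_cast congrArg (fun z : K => (z : ℂ)) (hrepr i)
    rw [norm_sub_rev, hacoe, hγ]
    exact (hdist i).trans (mul_le_mul_of_nonneg_right hAE (Real.rpow_nonneg (norm_nonneg _) _))

end Summit.Schanuel.Schanuel.Theorems.ApproximationPropertyDegOne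

end
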